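import Mathlib.LinearAlgebra.FiniteDimensional.Lemmas
import Mathlib.LinearAlgebra.Dimension.FreeAndStrongRankCondition
import HarnessLib

/-!
# Cliques of the Grassmann graph lie in a star or in a top (Chow 1949)

Let `V` be a vector space over a division ring `K` and let `Γ_{k+1}(V)` be the GRASSMANN GRAPH whose vertices are
the `(k+1)`-dimensional subspaces of `V`, two distinct subspaces being ADJACENT when they meet in a `k`-dimensional
subspace (equivalently, when their sum is `(k+2)`-dimensional).  A STAR is the set of all `(k+1)`-spaces through a
fixed `k`-space `E`; a TOP is the set of all `(k+1)`-spaces inside a fixed `(k+2)`-space `N`.  Both are cliques, and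

> every clique of `Γ_{k+1}(V)` is contained in a star or in a top

(M. Pankov, *Geometry of Semilinear Embeddings*, §3.2, Proposition 3.3 and the first line of its proof; the
statement goes back to W.-L. Chow, Ann. of Math. 50 (1949)).  Pankov states Prop. 3.3 as "if `1 < k < n − 1` every
MAXIMAL clique is a star or a top"; the containment form proved here needs no restriction on `k` or on `dim V`
(for lines, `k = 0`, the star through `E = ⊥` always works; for hyperplanes the top `N = V` does).

Main results (family form, any index type; any division ring; `V` need not be finite-dimensional):

* `grassmannClique_star_or_top`: if `P i` (`i : ι`) are subspaces of dimension `k + 1` any two DISTINCT ones of which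
  meet in dimension `k`, then either some `k`-dimensional `E` lies in every `P i` (STAR) or all `P i` lie in one
  subspace `N` of dimension `≤ k + 2` (TOP; `≤` only to cover the empty / constant family).
* `grassmannClique_star_or_top_set`: the same for a set `𝒳` of subspaces.

Proof (Pankov, loc. cit., verbatim structure).  If all `P i` coincide, TOP.  Else take `P i₁ ≠ P i₂`,
`E = P i₁ ⊓ P i₂` (`dim k`), `N = P i₁ ⊔ P i₂` (`dim k + 2`).  If `E ≤ P i` for all `i`, STAR.  Else some `P i₃ ⊉ E`.
KEY STEP (`inf_eq_inf_of_not_le`): if a `(k+1)`-space `S ⊄ N` is adjacent to `S' ≤ N` then `S ⊓ S' = S ⊓ N`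
(`S ⊓ S' ≤ S ⊓ N < S`, and the left side already has dimension `k`).  Applied to `S = P i₃` (if `P i₃ ⊄ N`) with
`S' = P i₁, P i₂` it gives `P i₃ ⊓ N ≤ E` with equal dimensions, so `E = P i₃ ⊓ N ≤ P i₃` — contradiction; hence
`P i₃ ≤ N`.  Then for any `P i ⊄ N` the same step with `S' = P i₁, P i₂, P i₃` gives `E = P i ⊓ N = P i ⊓ P i₃ ≤ P i₃`,
contradiction again; so every `P i ≤ N`: TOP.

Used by cell qa-qnc0 (QuantumAdvantage / RingFrame, tensor line, planner qa-qnc0-p2 ROUND-5 §2): the direction spaces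
of the minimum-weight coset leaders in the top layer of THEOREMS E2/E3/E4 form such a clique (`k + 1 = e`); the case
`k + 1 = 2` was proved ad hoc as `Summit.QuantumAdvantage.AdviceFreeQNC0.planes_star_or_top`; this file is the
general statement it defers to (`TODO(general form)` there).

WHAT THIS IS NOT: maximality of stars/tops and the equality form of Prop. 3.3 (every maximal clique IS a star or a
top, `1 < k+1 < dim V − 1`) are not formalised; nothing on automorphisms of Grassmann graphs (Chow's theorem proper).
-/

namespace Literature.LinearAlgebra.Subspace

open Module Submodule

variable {K V : Type*} [DivisionRing K] [AddCommGroup V] [Module K V]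

namespace GrassmannClique

/-- KEY STEP of Pankov's proof.  If `S` has dimension `k + 1`, is NOT contained in `N`, and meets some `S' ≤ N` in
dimension `k`, then `S ⊓ S' = S ⊓ N`.  [cite: Pankov2014, §3.2 Prop 3.3 (proof)] -/
theorem inf_eq_inf_of_not_le {k : ℕ} {S S' N : Submodule K V} [FiniteDimensional K S]
    (hS : finrank K S = k + 1) (hSN : ¬ S ≤ N) (hS'N : S' ≤ N) (hadj : finrank K ↥(S ⊓ S') = k) :
    S ⊓ S' = S ⊓ N := by
  haveI : FiniteDimensional K ↥(S ⊓ N) := Submodule.finiteDimensional_inf_left _ _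
  have hlt : S ⊓ N < S := lt_of_le_of_ne inf_le_left fun h => hSN (h ▸ inf_le_right)
  have hle : finrank K ↥(S ⊓ N) ≤ k := by
    have := Submodule.finrank_lt_finrank_of_lt hlt
    omega
  exact Submodule.eq_of_le_of_finrank_le (inf_le_inf_left S hS'N) (by rw [hadj]; exact hle)

end GrassmannClique

open GrassmannClique in
/-- **Cliques of the Grassmann graph: STAR or TOP** (Chow 1949; Pankov, Prop. 3.3).  Let `P i` (`i : ι`) be
`(k+1)`-dimensional subspaces of a vector space over a division ring such that any two distinct ones meet in a
`k`-dimensional subspace.  Then either some `k`-dimensional subspace `E` is contained in every `P i` (the family lies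
in the STAR of `E`), or there is a subspace `N` of dimension `≤ k + 2` containing every `P i` (the family lies in a
TOP).  [cite: Pankov2014, §3.2 Prop 3.3] -/
theorem grassmannClique_star_or_top {ι : Type*} {k : ℕ} (P : ι → Submodule K V)
    (hP : ∀ i, finrank K (P i) = k + 1)
    (hadj : ∀ i j, P i ≠ P j → finrank K ↥(P i ⊓ P j) = k) :
    (∃ E : Submodule K V, FiniteDimensional K E ∧ finrank K E = k ∧ ∀ i, E ≤ P i) ∨
      (∃ N : Submodule K V, FiniteDimensional K N ∧ finrank K N ≤ k + 2 ∧ ∀ i, P i ≤ N) := by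
  haveI hfin : ∀ i, FiniteDimensional K (P i) := fun i => Module.finite_of_finrank_eq_succ (hP i)
  by_cases hconst : ∀ i j, P i = P j
  · -- all members coincide (or there are none): TOP
    rcases isEmpty_or_nonempty ι with hι | ⟨⟨i₀⟩⟩
    · exact Or.inr ⟨⊥, inferInstance, by simp, fun i => (IsEmpty.false i).elim⟩
    · exact Or.inr ⟨P i₀, hfin i₀, by rw [hP i₀]; omega, fun i => (hconst i i₀).le⟩
  push Not at hconst
  obtain ⟨i₁, i₂, hne⟩ := hconst
  -- `E = P i₁ ⊓ P i₂` has dimension `k`, `N = P i₁ ⊔ P i₂` has dimension `k + 2`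
  obtain ⟨E, hE⟩ : ∃ E : Submodule K V, E = P i₁ ⊓ P i₂ := ⟨_, rfl⟩
  obtain ⟨N, hN⟩ : ∃ N : Submodule K V, N = P i₁ ⊔ P i₂ := ⟨_, rfl⟩
  haveI hEfin : FiniteDimensional K E := by rw [hE]; exact Submodule.finiteDimensional_inf_left _ _
  haveI hNfin : FiniteDimensional K N := by rw [hN]; exact Submodule.finiteDimensional_sup _ _
  have hEk : finrank K E = k := by rw [hE]; exact hadj i₁ i₂ hne
  have hNk : finrank K N = k + 2 := by
    have h := Submodule.finrank_sup_add_finrank_inf_eq (P i₁) (P i₂)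
    rw [hP, hP, ← hE, ← hN, hEk] at h
    omega
  have h1N : P i₁ ≤ N := by rw [hN]; exact le_sup_left
  have h2N : P i₂ ≤ N := by rw [hN]; exact le_sup_right
  have hE1 : E ≤ P i₁ := by rw [hE]; exact inf_le_left
  have hE2 : E ≤ P i₂ := by rw [hE]; exact inf_le_right
  by_cases hstar : ∀ i, E ≤ P i
  · exact Or.inl ⟨E, hEfin, hEk, hstar⟩
  push Not at hstar
  obtain ⟨i₃, h3⟩ := hstar
  right
  refine ⟨N, hNfin, hNk.le, ?_⟩
  -- the key step, packaged: a member outside `N` meets every member inside `N` exactly in its trace on `N`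
  have step : ∀ i j, ¬ P i ≤ N → P j ≤ N → P i ⊓ P j = P i ⊓ N := fun i j hiN hjN =>
    inf_eq_inf_of_not_le (hP i) hiN hjN (hadj i j fun h => hiN (h ▸ hjN))
  -- if `P i ⊄ N` then `P i ⊓ N = E`
  have trace_eq : ∀ i, ¬ P i ≤ N → P i ⊓ N = E := by
    intro i hiN
    have ha := step i i₁ hiN h1N
    have hb := step i i₂ hiN h2N
    have hle : P i ⊓ N ≤ E := by
      rw [hE]
      exact le_inf (by rw [← ha]; exact inf_le_right) (by rw [← hb]; exact inf_le_right)
    have hdim : finrank K ↥(P i ⊓ N) = k := by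
      rw [← ha]; exact hadj i i₁ fun h => hiN (h ▸ h1N)
    exact Submodule.eq_of_le_of_finrank_le hle (by rw [hEk, hdim])
  -- `P i₃ ≤ N`
  have h3N : P i₃ ≤ N := by
    by_contra h
    exact h3 (by rw [← trace_eq i₃ h]; exact inf_le_left)
  -- every member lies in `N`
  intro i
  by_contra hiN
  have hc := step i i₃ hiN h3N
  exact h3 (by rw [← trace_eq i hiN, ← hc]; exact inf_le_right)

/-- Set form of `grassmannClique_star_or_top`: a set `𝒳` of `(k+1)`-dimensional subspaces, pairwise (when distinct)
meeting in dimension `k`, lies in a star (common `k`-space) or in a top (common space of dimension `≤ k + 2`).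
[cite: Pankov2014, §3.2 Prop 3.3] -/
theorem grassmannClique_star_or_top_set {k : ℕ} (𝒳 : Set (Submodule K V))
    (hP : ∀ S ∈ 𝒳, finrank K S = k + 1)
    (hadj : ∀ S ∈ 𝒳, ∀ U ∈ 𝒳, S ≠ U → finrank K ↥(S ⊓ U) = k) :
    (∃ E : Submodule K V, FiniteDimensional K E ∧ finrank K E = k ∧ ∀ S ∈ 𝒳, E ≤ S) ∨
      (∃ N : Submodule K V, FiniteDimensional K N ∧ finrank K N ≤ k + 2 ∧ ∀ S ∈ 𝒳, S ≤ N) := by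
  rcases grassmannClique_star_or_top (fun S : 𝒳 => (S : Submodule K V)) (fun S => hP S S.2)
      (fun S U h => hadj S S.2 U U.2 h) with ⟨E, hEf, hEk, hE⟩ | ⟨N, hNf, hNk, hN⟩
  · exact Or.inl ⟨E, hEf, hEk, fun S hS => hE ⟨S, hS⟩⟩
  · exact Or.inr ⟨N, hNf, hNk, fun S hS => hN ⟨S, hS⟩⟩

end Literature.LinearAlgebra.Subspace
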